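import Summits.RiemannHypothesis.RiemannHypothesis.Theses.Fences

/-!
# Line `step-from-inverse` for the piece `ZeroChainStep` (stmt-RiemannHypothesis-17850)

crux-strategist r1 (seat of ClusterForcing, stmt-14530), 2026-08-17. The child crux
`ZeroChainStep` of the BC2 redirect of `ClusterForcing` is supplied by three route items BY NAME:

* `stub_twoSidedPowerSum`  = stmt-RiemannHypothesis-14529 `TwoSidedPowerSum` (crux, rank 2, OPEN —
  the budgeted two-sided power-sum inverse theorem; the one hard leaf);
* `stub_localZeroPowerSum` = stmt-RiemannHypothesis-17851 `LocalZeroPowerSum` (support, provable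
  now from the tree's Maynard–Pratt toolkit: explicit formula at a zero in budget currency);
* `stub_stepFromInverse`   = stmt-RiemannHypothesis-17860 `StepFromInverse` (support, provable now:
  the budget bookkeeping `TwoSidedPowerSum → LocalZeroPowerSum → ZeroChainStep`).

Composition = modus ponens. Hardest stub: `stub_twoSidedPowerSum` (XL, open; kill criterion of the
route). Stub probes (bc/probes3.lean of the seat): `stub → ZeroChainStep`, `stub → Summit` fail.
-/

namespace Summit.RiemannHypothesis.RiemannHypothesis.Cruxes.ZeroChainStep.StepFromInverse

open Summit.RiemannHypothesis.RiemannHypothesis.Theses.Fences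

/-- stub 1 = route item stmt-RiemannHypothesis-14529 (crux, rank 2). -/
theorem stub_twoSidedPowerSum : TwoSidedPowerSum := by
  sorry

/-- stub 2 = route item stmt-RiemannHypothesis-17851 (support, provable now). -/
theorem stub_localZeroPowerSum : LocalZeroPowerSum := by
  sorry

/-- stub 3 = route item stmt-RiemannHypothesis-17860 (support, provable now). -/
theorem stub_stepFromInverse :
    Summit.RiemannHypothesis.RiemannHypothesis.Theses.Fences.StepFromInverse := by
  sorry

/-- The composition: the piece BY NAME from the three stubs. -/
theorem ZeroChainStep_of : TwoSidedPowerSum → LocalZeroPowerSum →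
    Summit.RiemannHypothesis.RiemannHypothesis.Theses.Fences.StepFromInverse →
    Summit.RiemannHypothesis.RiemannHypothesis.Theses.Fences.ZeroChainStep :=
  fun h₀ hL hB => hB h₀ hL

/-- Hence the piece (modulo the stubs). -/
theorem zeroChainStep : Summit.RiemannHypothesis.RiemannHypothesis.Theses.Fences.ZeroChainStep :=
  ZeroChainStep_of stub_twoSidedPowerSum stub_localZeroPowerSum stub_stepFromInverse

end Summit.RiemannHypothesis.RiemannHypothesis.Cruxes.ZeroChainStep.StepFromInverse
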